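import Mathlib.Analysis.Calculus.ContDiff.Bounds
import Mathlib.Analysis.Complex.OperatorNorm
import Literature.Analysis.FluidPDE.MikadoShearPotential
import Literature.MathematicalPhysics.QuantumLattice.SchwartzFourierDensity
import HarnessLib

/-!
# All-orders derivative bounds for the Mikado-flow vector potentials of Coiculescu–Palasek:
# `‖∇^m Ψ⁰_{j,k}‖_∞ ≲_m N_k^{-2+m}` (Lemma 3.2 (1))

Analysis/FluidPDE support file (all results proved; no definitions, no named facts), continuing
`MikadoShearPotential` (`CP25.mikadoPotential θ k Λ g M N x = N⁻² g(M • x) Re(Λ e_k(x)) θ`, the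
transported Mikado potential of M. P. Coiculescu, S. Palasek, *Non-uniqueness of smooth solutions
of the Navier–Stokes equations from critical data*, Invent. Math. 244 (2025), arXiv:2503.14699,
Def. 3.1). **Lemma 3.2 (1)** asserts `‖∇^m Ψ⁰_{j,k}‖_{L^∞(𝕋³)} ≲_m N_k^{-2+m}` ("elementary consequences
of Definition 3.1": each derivative falls either on the pipe profile `φ̃_j(M_k x)`, costing
`M_k ≤ N_k`, or on the phase `sin(N_k(x - x_j)·η_j)`, costing `N_k|η_j|`). In the tree's conventions
(`CoiculescuPalasek2025.IsApproximateSolution.deriv_le`: sup norms of `iteratedFDeriv ℝ m` of the periodic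
LIFT `Torus.lift`) this file proves, by the Leibniz bound `norm_iteratedFDeriv_mul_le`:

* `CP25.norm_iteratedFDeriv_lift_shearPhase_le` — `‖Dʲ(Re(Λ e_k) ∘ proj)(y)‖ ≤ ‖Λ‖ (2π|k|₁)ʲ` (the
  character bound `QuantumLattice.norm_iteratedFDeriv_eChar_le`);
* `CP25.norm_iteratedFDeriv_lift_comp_nsmul_le` — `‖Dⁱ(g(M•·) ∘ proj)(y)‖ ≤ Mⁱ ‖Dⁱ(g ∘ proj)(My)‖`;
* `CP25.norm_iteratedFDeriv_lift_mikadoPotential_le` — **the Leibniz bound**: if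
  `‖Dⁱ(g ∘ proj)‖ ≤ Gᵢ` for `i ≤ m` then
  `‖Dᵐ(Ψ ∘ proj)(y)‖ ≤ N⁻² ‖θ‖ ‖Λ‖ ∑ᵢ (m choose i) Mⁱ Gᵢ (2π|k|₁)^{m-i}`;
* `CP25.norm_iteratedFDeriv_lift_mikadoPotential_le_pow` — **Lemma 3.2 (1) in the paper's scaling**:
  for `k = N • η` and `M ≤ N`, `‖Dᵐ(Ψ ∘ proj)(y)‖ ≤ N⁻² Nᵐ · ‖θ‖ ‖Λ‖ ∑ᵢ (m choose i) Gᵢ (2π|η|₁)^{m-i}`,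
  i.e. `≲_m N^{-2+m}` with a constant depending only on `m`, `θ`, `η`, `Λ` and the profile.

## Mathlib / tree search

Mathlib: `norm_iteratedFDeriv_mul_le`, `ContinuousLinearMap.norm_iteratedFDeriv_comp_left`,
`ContinuousLinearMap.iteratedFDeriv_comp_right`, `ContinuousMultilinearMap.norm_compContinuousLinearMap_le`,
`Complex.reCLM_norm`. Tree: `QuantumLattice.eChar`, `mFourier_coe_eq_eChar`,
`norm_iteratedFDeriv_eChar_le`, `absSum` (`MathematicalPhysics/QuantumLattice/SchwartzFourierDensity`
— the same all-orders character bounds serve the refutation file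
`Barriers/NavierStokesRegularity/CriticalDataSmoothNonuniquenessPerturbationRefuted`),
`FluidPDE.proj_natCast_smul` (`ZerothLawProofs`).

## References

* M. P. Coiculescu, S. Palasek, Invent. Math. 244 (2025) 165–219, doi:10.1007/s00222-025-01396-z,
  arXiv:2503.14699: Def. 3.1, Lemma 3.2 (1) (mikadoprofilebound). [CoiculescuPalasek2025]
-/

noncomputable section

open Set Function UnitAddTorus
open scoped BigOperators

namespace Literature.Analysis.FluidPDE

namespace CP25

open Literature.Analysis.FunctionSpaces Literature.Analysis.FunctionSpaces.Torus
open Literature.MathematicalPhysics.QuantumLattice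

variable {d : Type*} [Fintype d] [DecidableEq d]

/-! ## The lifted phase -/

omit [DecidableEq d] in
/-- The lifted character: `e_k(proj y) = e^{2πi k·y}`. [folklore] -/
theorem mFourier_proj_eq_eChar (k : d → ℤ) (y : EuclideanSpace ℝ d) :
    mFourier k (Torus.proj y) = eChar k y :=
  mFourier_coe_eq_eChar k (WithLp.ofLp y)

omit [DecidableEq d] in
/-- The lift of the phase `Re(Λ e_k)` is the character followed by the real-linear map
`z ↦ Re(Λ z)`. [folklore] -/
theorem lift_shearPhase (k : d → ℤ) (Λ : ℂ) :
    Torus.lift (shearPhase (d := d) k Λ) =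
      (Complex.reCLM.comp (ContinuousLinearMap.mul ℝ ℂ Λ)) ∘ eChar k := by
  funext y
  simp only [Torus.lift_apply, shearPhase, comp_apply, ContinuousLinearMap.comp_apply,
    ContinuousLinearMap.mul_apply', Complex.reCLM_apply, mFourier_proj_eq_eChar]

omit [DecidableEq d] in
/-- `‖z ↦ Re(Λ z)‖ ≤ ‖Λ‖`. [folklore] -/
theorem norm_reCLM_comp_mul_le (Λ : ℂ) :
    ‖(Complex.reCLM.comp (ContinuousLinearMap.mul ℝ ℂ Λ) : ℂ →L[ℝ] ℝ)‖ ≤ ‖Λ‖ := by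
  refine ContinuousLinearMap.opNorm_le_bound _ (norm_nonneg _) fun z => ?_
  simp only [ContinuousLinearMap.comp_apply, ContinuousLinearMap.mul_apply', Complex.reCLM_apply]
  exact (Complex.abs_re_le_norm _).trans (norm_mul_le _ _)

omit [DecidableEq d] in
/-- **Derivatives of the lifted phase**: `‖Dʲ(Re(Λ e_k) ∘ proj)(y)‖ ≤ ‖Λ‖ (2π|k|₁)ʲ`.
[cite: CoiculescuPalasek2025, Lemma 3.2 (1) (proof: derivatives falling on the sine)] -/
theorem norm_iteratedFDeriv_lift_shearPhase_le (k : d → ℤ) (Λ : ℂ) (j : ℕ)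
    (y : EuclideanSpace ℝ d) :
    ‖iteratedFDeriv ℝ j (Torus.lift (shearPhase (d := d) k Λ)) y‖ ≤
      ‖Λ‖ * (2 * Real.pi * absSum k) ^ j := by
  rw [lift_shearPhase]
  have hf : ContDiffAt ℝ (j : ℕ∞) (eChar (ι := d) k) y := (contDiff_eChar k).contDiffAt
  refine ((Complex.reCLM.comp (ContinuousLinearMap.mul ℝ ℂ Λ)).norm_iteratedFDeriv_comp_left hf
    (by exact_mod_cast le_rfl)).trans ?_
  exact mul_le_mul (norm_reCLM_comp_mul_le Λ) (norm_iteratedFDeriv_eChar_le k j y)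
    (norm_nonneg _) (norm_nonneg _)

omit [DecidableEq d] in
/-- The lifted phase is `C^n` for every finite or infinite `n : ℕ∞`. [folklore] -/
theorem contDiff_lift_shearPhase (k : d → ℤ) (Λ : ℂ) (n : ℕ∞) :
    ContDiff ℝ n (Torus.lift (shearPhase (d := d) k Λ)) :=
  (isSmooth_shearPhase k Λ).of_le (by exact_mod_cast le_top)

/-! ## The lifted rescaled profile -/

variable {F : Type*} [NormedAddCommGroup F] [NormedSpace ℝ F]

omit [DecidableEq d] [NormedAddCommGroup F] [NormedSpace ℝ F] in
/-- The lift of `g(M • ·)` is the lift of `g` composed with the dilation `y ↦ My`. [folklore] -/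
theorem lift_comp_nsmul_eq (g : UnitAddTorus d → F) (M : ℕ) :
    Torus.lift (fun x : UnitAddTorus d => g (M • x)) =
      Torus.lift g ∘ ((M : ℝ) • ContinuousLinearMap.id ℝ (EuclideanSpace ℝ d)) := by
  funext y
  simp only [Torus.lift_apply, comp_apply, smul_apply,
    ContinuousLinearMap.id_apply, proj_natCast_smul]

omit [DecidableEq d] in
/-- `‖M • id‖ ≤ M`. [folklore] -/
theorem norm_natCast_smul_id_le (M : ℕ) :
    ‖((M : ℝ) • ContinuousLinearMap.id ℝ (EuclideanSpace ℝ d))‖ ≤ M := by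
  refine ContinuousLinearMap.opNorm_le_bound _ (Nat.cast_nonneg M) fun y => ?_
  rw [smul_apply, ContinuousLinearMap.id_apply, norm_smul, Real.norm_natCast]

omit [DecidableEq d] in
/-- **Derivatives of the lifted rescaled profile**: `‖Dⁱ(g(M•·) ∘ proj)(y)‖ ≤ Mⁱ ‖Dⁱ(g ∘ proj)(My)‖`
for smooth `g`. [cite: CoiculescuPalasek2025, Lemma 3.2 (1) (proof: derivatives falling on `φ̃_j(M_kx)`)] -/
theorem norm_iteratedFDeriv_lift_comp_nsmul_le {g : UnitAddTorus d → F} (hg : Torus.IsSmooth g)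
    (M i : ℕ) (y : EuclideanSpace ℝ d) :
    ‖iteratedFDeriv ℝ i (Torus.lift (fun x : UnitAddTorus d => g (M • x))) y‖ ≤
      (M : ℝ) ^ i * ‖iteratedFDeriv ℝ i (Torus.lift g) ((M : ℝ) • y)‖ := by
  set L : EuclideanSpace ℝ d →L[ℝ] EuclideanSpace ℝ d :=
    (M : ℝ) • ContinuousLinearMap.id ℝ (EuclideanSpace ℝ d) with hL
  have hgC : ContDiff ℝ (i : ℕ∞) (Torus.lift g) := hg.of_le (by exact_mod_cast le_top)
  rw [lift_comp_nsmul_eq, ← hL, L.iteratedFDeriv_comp_right hgC y (by exact_mod_cast le_rfl)]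
  refine (ContinuousMultilinearMap.norm_compContinuousLinearMap_le _ _).trans ?_
  rw [Finset.prod_const, Finset.card_univ, Fintype.card_fin, mul_comm]
  have hLy : L y = (M : ℝ) • y := rfl
  rw [hLy]
  refine mul_le_mul_of_nonneg_right (pow_le_pow_left₀ (norm_nonneg _) ?_ i) (norm_nonneg _)
  exact norm_natCast_smul_id_le M

/-! ## The Leibniz bound for the potential -/

omit [DecidableEq d] in
/-- The lift of the potential factors through the real-linear map `t ↦ (N⁻² t) θ`:
`Ψ ∘ proj = (t ↦ N⁻² t • θ) ∘ ((g(M•·) ∘ proj) · (Re(Λe_k) ∘ proj))`. [folklore] -/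
theorem lift_mikadoPotential_eq (θ k : d → ℤ) (Λ : ℂ) (g : UnitAddTorus d → ℝ) (M N : ℕ) :
    Torus.lift (mikadoPotential θ k Λ g M N) =
      ((((N : ℝ) ^ 2)⁻¹ • (ContinuousLinearMap.id ℝ ℝ).smulRight (dirVec θ)) : ℝ →L[ℝ] _) ∘
        fun y => Torus.lift (fun x : UnitAddTorus d => g (M • x)) y *
          Torus.lift (shearPhase (d := d) k Λ) y := by
  funext y
  simp only [Torus.lift_apply, comp_apply, mikadoPotential_apply, mikadoAmp,
    smul_apply, ContinuousLinearMap.smulRight_apply,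
    ContinuousLinearMap.id_apply, smul_smul]

omit [DecidableEq d] in
/-- `‖t ↦ (N⁻² t) θ‖ ≤ N⁻² ‖θ‖`. [folklore] -/
theorem norm_smul_smulRight_dirVec_le (θ : d → ℤ) (N : ℕ) :
    ‖((((N : ℝ) ^ 2)⁻¹ • (ContinuousLinearMap.id ℝ ℝ).smulRight (dirVec θ)) : ℝ →L[ℝ] _)‖ ≤
      ((N : ℝ) ^ 2)⁻¹ * ‖dirVec θ‖ := by
  refine ContinuousLinearMap.opNorm_le_bound _ (by positivity) fun t => ?_
  simp only [smul_apply, ContinuousLinearMap.smulRight_apply,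
    ContinuousLinearMap.id_apply]
  rw [norm_smul, norm_smul, Real.norm_eq_abs, Real.norm_eq_abs,
    abs_of_nonneg (by positivity : (0 : ℝ) ≤ ((N : ℝ) ^ 2)⁻¹)]
  nlinarith [norm_nonneg (dirVec θ), abs_nonneg t]

omit [DecidableEq d] in
/-- **Lemma 3.2 (1), the Leibniz bound.** If `‖Dⁱ(g ∘ proj)‖ ≤ Gᵢ` everywhere for `i ≤ m` (the
profile with all its derivatives bounded), then
`‖Dᵐ(Ψ ∘ proj)(y)‖ ≤ N⁻² ‖θ‖ ‖Λ‖ ∑_{i ≤ m} (m choose i) (Mⁱ Gᵢ) (2π|k|₁)^{m-i}`.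
[cite: CoiculescuPalasek2025, Lemma 3.2 (1) (mikadoprofilebound)] -/
theorem norm_iteratedFDeriv_lift_mikadoPotential_le (θ k : d → ℤ) (Λ : ℂ)
    {g : UnitAddTorus d → ℝ} (hg : Torus.IsSmooth g) {G : ℕ → ℝ} {m : ℕ}
    (hG : ∀ i ≤ m, ∀ z : EuclideanSpace ℝ d, ‖iteratedFDeriv ℝ i (Torus.lift g) z‖ ≤ G i)
    (M N : ℕ) (y : EuclideanSpace ℝ d) :
    ‖iteratedFDeriv ℝ m (Torus.lift (mikadoPotential θ k Λ g M N)) y‖ ≤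
      ((N : ℝ) ^ 2)⁻¹ * ‖dirVec θ‖ * ‖Λ‖ *
        ∑ i ∈ Finset.range (m + 1),
          (m.choose i : ℝ) * ((M : ℝ) ^ i * G i) * (2 * Real.pi * absSum k) ^ (m - i) := by
  set a : EuclideanSpace ℝ d → ℝ := Torus.lift (fun x : UnitAddTorus d => g (M • x)) with ha
  set b : EuclideanSpace ℝ d → ℝ := Torus.lift (shearPhase (d := d) k Λ) with hb
  set L : ℝ →L[ℝ] EuclideanSpace ℝ d :=
    ((N : ℝ) ^ 2)⁻¹ • (ContinuousLinearMap.id ℝ ℝ).smulRight (dirVec θ) with hL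
  have haC : ContDiff ℝ (m : ℕ∞) a := (isSmooth_comp_nsmul hg M).of_le (by exact_mod_cast le_top)
  have hbC : ContDiff ℝ (m : ℕ∞) b := contDiff_lift_shearPhase k Λ m
  have habC : ContDiffAt ℝ (m : ℕ∞) (fun y => a y * b y) y := (haC.mul hbC).contDiffAt
  rw [lift_mikadoPotential_eq, ← ha, ← hb, ← hL]
  refine (L.norm_iteratedFDeriv_comp_left habC (by exact_mod_cast le_rfl)).trans ?_
  have hLn := norm_smul_smulRight_dirVec_le θ N
  rw [← hL] at hLn
  -- Leibniz
  have hleib := norm_iteratedFDeriv_mul_le haC hbC y (n := m) (by exact_mod_cast le_rfl)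
  -- the termwise bounds
  have hterm : ∀ i ∈ Finset.range (m + 1),
      (m.choose i : ℝ) * ‖iteratedFDeriv ℝ i a y‖ * ‖iteratedFDeriv ℝ (m - i) b y‖ ≤
        (m.choose i : ℝ) * ((M : ℝ) ^ i * G i) * (‖Λ‖ * (2 * Real.pi * absSum k) ^ (m - i)) := by
    intro i hi
    have him : i ≤ m := Nat.lt_succ_iff.1 (Finset.mem_range.1 hi)
    have h1 : ‖iteratedFDeriv ℝ i a y‖ ≤ (M : ℝ) ^ i * G i :=
      (norm_iteratedFDeriv_lift_comp_nsmul_le hg M i y).trans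
        (mul_le_mul_of_nonneg_left (hG i him _) (by positivity))
    have h2 : ‖iteratedFDeriv ℝ (m - i) b y‖ ≤ ‖Λ‖ * (2 * Real.pi * absSum k) ^ (m - i) :=
      norm_iteratedFDeriv_lift_shearPhase_le k Λ (m - i) y
    have h0 : 0 ≤ (m.choose i : ℝ) := Nat.cast_nonneg _
    calc (m.choose i : ℝ) * ‖iteratedFDeriv ℝ i a y‖ * ‖iteratedFDeriv ℝ (m - i) b y‖
        ≤ (m.choose i : ℝ) * ((M : ℝ) ^ i * G i) * ‖iteratedFDeriv ℝ (m - i) b y‖ :=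
          mul_le_mul_of_nonneg_right (mul_le_mul_of_nonneg_left h1 h0) (norm_nonneg _)
      _ ≤ (m.choose i : ℝ) * ((M : ℝ) ^ i * G i) * (‖Λ‖ * (2 * Real.pi * absSum k) ^ (m - i)) := by
          refine mul_le_mul_of_nonneg_left h2 ?_
          have : 0 ≤ (M : ℝ) ^ i * G i := le_trans (by positivity) h1
          positivity
  have hsum := (hleib.trans (Finset.sum_le_sum hterm))
  have hrhs : ∑ i ∈ Finset.range (m + 1),
      (m.choose i : ℝ) * ((M : ℝ) ^ i * G i) * (‖Λ‖ * (2 * Real.pi * absSum k) ^ (m - i)) =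
      ‖Λ‖ * ∑ i ∈ Finset.range (m + 1),
        (m.choose i : ℝ) * ((M : ℝ) ^ i * G i) * (2 * Real.pi * absSum k) ^ (m - i) := by
    rw [Finset.mul_sum]
    refine Finset.sum_congr rfl fun i _ => ?_
    ring
  rw [hrhs] at hsum
  have hS0 : 0 ≤ ‖Λ‖ * ∑ i ∈ Finset.range (m + 1),
      (m.choose i : ℝ) * ((M : ℝ) ^ i * G i) * (2 * Real.pi * absSum k) ^ (m - i) :=
    le_trans (norm_nonneg _) hsum
  calc ‖L‖ * ‖iteratedFDeriv ℝ m (fun y => a y * b y) y‖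
      ≤ (((N : ℝ) ^ 2)⁻¹ * ‖dirVec θ‖) * (‖Λ‖ * ∑ i ∈ Finset.range (m + 1),
          (m.choose i : ℝ) * ((M : ℝ) ^ i * G i) * (2 * Real.pi * absSum k) ^ (m - i)) :=
        mul_le_mul hLn hsum (norm_nonneg _) (by positivity)
    _ = _ := by ring

/-! ## The paper's scaling: `k = N η`, `M ≤ N` -/

omit [DecidableEq d] in
/-- `|N η|₁ = N |η|₁`. [folklore] -/
theorem absSum_natCast_smul (N : ℕ) (η : d → ℤ) : absSum ((N : ℤ) • η) = N * absSum η := by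
  simp only [absSum, Pi.smul_apply, smul_eq_mul, Int.cast_mul, Int.cast_natCast, abs_mul,
    Nat.abs_cast, Finset.mul_sum]

omit [DecidableEq d] in
/-- **Lemma 3.2 (1) in the paper's scaling: `‖∇^mΨ⁰‖_∞ ≲_m N^{-2+m}`.** For the phase frequency
`k = N η` and a profile rescaled by `M ≤ N`, with `‖Dⁱ(g ∘ proj)‖ ≤ Gᵢ` (`i ≤ m`):
`‖Dᵐ(Ψ ∘ proj)(y)‖ ≤ N⁻² Nᵐ · ‖θ‖ ‖Λ‖ ∑_{i ≤ m} (m choose i) Gᵢ (2π|η|₁)^{m-i}` — the constant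
depends on `m, θ, η, Λ` and the profile, not on `N`, `M`.
[cite: CoiculescuPalasek2025, Lemma 3.2 (1) (mikadoprofilebound)] -/
theorem norm_iteratedFDeriv_lift_mikadoPotential_le_pow (θ η : d → ℤ) (Λ : ℂ)
    {g : UnitAddTorus d → ℝ} (hg : Torus.IsSmooth g) {G : ℕ → ℝ} {m : ℕ}
    (hG : ∀ i ≤ m, ∀ z : EuclideanSpace ℝ d, ‖iteratedFDeriv ℝ i (Torus.lift g) z‖ ≤ G i)
    {M N : ℕ} (hMN : M ≤ N) (y : EuclideanSpace ℝ d) :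
    ‖iteratedFDeriv ℝ m (Torus.lift (mikadoPotential θ ((N : ℤ) • η) Λ g M N)) y‖ ≤
      ((N : ℝ) ^ 2)⁻¹ * (N : ℝ) ^ m * (‖dirVec θ‖ * ‖Λ‖ *
        ∑ i ∈ Finset.range (m + 1), (m.choose i : ℝ) * G i * (2 * Real.pi * absSum η) ^ (m - i)) := by
  have h := norm_iteratedFDeriv_lift_mikadoPotential_le θ ((N : ℤ) • η) Λ hg hG M N y
  refine h.trans ?_
  rw [absSum_natCast_smul]
  have hG0 : ∀ i ∈ Finset.range (m + 1), 0 ≤ G i := fun i hi =>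
    le_trans (norm_nonneg _) (hG i (Nat.lt_succ_iff.1 (Finset.mem_range.1 hi)) 0)
  have hMN' : (M : ℝ) ≤ N := by exact_mod_cast hMN
  -- termwise: `Mⁱ (2πN|η|₁)^{m-i} ≤ Nᵐ (2π|η|₁)^{m-i}`
  have hterm : ∀ i ∈ Finset.range (m + 1),
      (m.choose i : ℝ) * ((M : ℝ) ^ i * G i) * (2 * Real.pi * (N * absSum η)) ^ (m - i) ≤
        (N : ℝ) ^ m * ((m.choose i : ℝ) * G i * (2 * Real.pi * absSum η) ^ (m - i)) := by
    intro i hi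
    have him : i ≤ m := Nat.lt_succ_iff.1 (Finset.mem_range.1 hi)
    have hpow : (M : ℝ) ^ i * (N : ℝ) ^ (m - i) ≤ (N : ℝ) ^ m := by
      calc (M : ℝ) ^ i * (N : ℝ) ^ (m - i) ≤ (N : ℝ) ^ i * (N : ℝ) ^ (m - i) :=
            mul_le_mul_of_nonneg_right (pow_le_pow_left₀ (Nat.cast_nonneg _) hMN' i)
              (by positivity)
        _ = (N : ℝ) ^ m := by rw [← pow_add, Nat.add_sub_cancel' him]
    have hsplit : (2 * Real.pi * (N * absSum η)) ^ (m - i) =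
        (N : ℝ) ^ (m - i) * (2 * Real.pi * absSum η) ^ (m - i) := by
      rw [← mul_pow]; ring
    rw [hsplit]
    have h0 : 0 ≤ (m.choose i : ℝ) * G i * (2 * Real.pi * absSum η) ^ (m - i) := by
      have := hG0 i hi
      have : 0 ≤ absSum η := absSum_nonneg η
      positivity
    calc (m.choose i : ℝ) * ((M : ℝ) ^ i * G i) * ((N : ℝ) ^ (m - i) * (2 * Real.pi * absSum η) ^ (m - i))
        = ((M : ℝ) ^ i * (N : ℝ) ^ (m - i)) *
            ((m.choose i : ℝ) * G i * (2 * Real.pi * absSum η) ^ (m - i)) := by ring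
      _ ≤ (N : ℝ) ^ m * ((m.choose i : ℝ) * G i * (2 * Real.pi * absSum η) ^ (m - i)) :=
          mul_le_mul_of_nonneg_right hpow h0
  have hsum := Finset.sum_le_sum hterm
  rw [← Finset.mul_sum] at hsum
  have hc : 0 ≤ ((N : ℝ) ^ 2)⁻¹ * ‖dirVec θ‖ * ‖Λ‖ := by positivity
  calc ((N : ℝ) ^ 2)⁻¹ * ‖dirVec θ‖ * ‖Λ‖ *
        ∑ i ∈ Finset.range (m + 1),
          (m.choose i : ℝ) * ((M : ℝ) ^ i * G i) * (2 * Real.pi * (N * absSum η)) ^ (m - i)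
      ≤ ((N : ℝ) ^ 2)⁻¹ * ‖dirVec θ‖ * ‖Λ‖ * ((N : ℝ) ^ m *
          ∑ i ∈ Finset.range (m + 1), (m.choose i : ℝ) * G i * (2 * Real.pi * absSum η) ^ (m - i)) :=
        mul_le_mul_of_nonneg_left hsum hc
    _ = _ := by ring

end CP25

end Literature.Analysis.FluidPDE
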